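import Summits.HubbardSuperconductivity.HubbardSuperconductivity.Theorems.NodalWardXYDefs

/-!
# `PerturbedXYOrder` (stmt-HubbardSuperconductivity-10739) — line `schwarz-inheritance`, stub `stub_entire`

Entire dependence of Z(tK) and num(tK) on the complex coupling t (differentiation under the integral sign).
-/

noncomputable section

namespace Summit.HubbardSuperconductivity.HubbardSuperconductivity.Theorems.PerturbedXYOrder

open MeasureTheory Literature.Probability.LatticeModels
open Summit.HubbardSuperconductivity.HubbardSuperconductivity.Theses.NodalWardXY

/-- **Differentiation under the integral sign (generic).** On a finite measure space, for bounded
strongly measurable `g, W : α → ℂ`, the parametric integral `t ↦ ∫ g · exp(t W)` is complex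
differentiable on all of `ℂ` (dominated derivative `g W exp(t W)` on unit balls,
`hasDerivAt_integral_of_dominated_loc_of_deriv_le`). [folklore] -/
theorem ent_differentiable_integral_mul_cexp {α : Type*} [MeasurableSpace α] {μ : Measure α}
    [IsFiniteMeasure μ] {g W : α → ℂ} (hg : AEStronglyMeasurable g μ)
    (hW : AEStronglyMeasurable W μ) {G M : ℝ} (hgb : ∀ a, ‖g a‖ ≤ G) (hWb : ∀ a, ‖W a‖ ≤ M) :
    Differentiable ℂ fun t : ℂ => ∫ a, g a * Complex.exp (t * W a) ∂μ := by
  -- measurability of the integrand and of its `t`-derivative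
  have hmeas : ∀ t : ℂ, AEStronglyMeasurable (fun a => g a * Complex.exp (t * W a)) μ := fun t =>
    hg.mul (Complex.continuous_exp.comp_aestronglyMeasurable (hW.const_mul t))
  have hmeas' : ∀ t : ℂ, AEStronglyMeasurable (fun a => g a * (Complex.exp (t * W a) * W a)) μ :=
    fun t => hg.mul ((Complex.continuous_exp.comp_aestronglyMeasurable (hW.const_mul t)).mul hW)
  -- the pointwise bound `‖g exp(tW) W‖ ≤ G e^{R M} M` for `‖t‖ ≤ R`
  have hexp : ∀ (t : ℂ) (R : ℝ), ‖t‖ ≤ R → ∀ a, ‖Complex.exp (t * W a)‖ ≤ Real.exp (R * M) := by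
    intro t R htR a
    have hM0 : 0 ≤ M := (norm_nonneg _).trans (hWb a)
    refine (Complex.norm_exp_le_exp_norm _).trans (Real.exp_le_exp.2 ?_)
    rw [norm_mul]
    exact mul_le_mul htR (hWb a) (norm_nonneg _) ((norm_nonneg _).trans htR)
  have hbd : ∀ (t : ℂ) (R : ℝ), ‖t‖ ≤ R → ∀ a,
      ‖g a * (Complex.exp (t * W a) * W a)‖ ≤ G * (Real.exp (R * M) * M) := by
    intro t R htR a
    have hG0 : 0 ≤ G := (norm_nonneg _).trans (hgb a)
    rw [norm_mul, norm_mul]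
    exact mul_le_mul (hgb a) (mul_le_mul (hexp t R htR a) (hWb a) (norm_nonneg _) (Real.exp_nonneg _))
      (by positivity) hG0
  intro t₀
  have key := hasDerivAt_integral_of_dominated_loc_of_deriv_le
    (F := fun t a => g a * Complex.exp (t * W a)) (F' := fun t a => g a * (Complex.exp (t * W a) * W a))
    (x₀ := t₀) (bound := fun _ => G * (Real.exp ((‖t₀‖ + 1) * M) * M)) (s := Metric.ball t₀ 1) (μ := μ)
    (Metric.ball_mem_nhds t₀ one_pos) (Filter.Eventually.of_forall hmeas) ?_ (hmeas' t₀) ?_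
    (integrable_const _) ?_
  · exact key.2.differentiableAt
  · -- integrability of the integrand at `t₀`: bounded on a finite measure
    refine Integrable.of_bound (hmeas t₀) (G * Real.exp (‖t₀‖ * M)) (ae_of_all _ fun a => ?_)
    have hG0 : 0 ≤ G := (norm_nonneg _).trans (hgb a)
    rw [norm_mul]
    exact mul_le_mul (hgb a) (hexp t₀ ‖t₀‖ le_rfl a) (norm_nonneg _) hG0
  · refine ae_of_all _ fun a t ht => hbd t (‖t₀‖ + 1) ?_ a
    have h1 : ‖t - t₀‖ < 1 := by rwa [Metric.mem_ball, dist_eq_norm] at ht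
    have h2 : ‖t‖ - ‖t₀‖ ≤ ‖t - t₀‖ := norm_sub_norm_le t t₀
    linarith
  · exact ae_of_all _ fun a t _ => ((hasDerivAt_mul_const (W a)).cexp).const_mul (g a)

variable {L : ℕ}

/-- The configuration cube is compact. -/
theorem ent_isCompact_cube : IsCompact (cube L) := isCompact_univ_pi fun _ => isCompact_Icc

/-- Lebesgue measure restricted to the configuration cube is a finite measure. -/
theorem ent_isFiniteMeasure_restrict_cube [NeZero L] :
    IsFiniteMeasure ((volume : Measure (TorusSite 3 L → ℝ)).restrict (cube L)) :=
  isFiniteMeasure_restrict.2 (ent_isCompact_cube (L := L)).measure_lt_top.ne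

/-- Scaling the kernel scales the perturbation: `W_{tK} = t W_K`. -/
theorem ent_Wk_smul [NeZero L] (t : ℂ) (K : Bond L → Bond L → ℂ) (θ : TorusSite 3 L → ℝ) :
    Wk (t • K) θ = t * Wk K θ := by
  unfold Wk
  rw [Finset.mul_sum]
  refine Finset.sum_congr rfl fun b _ => ?_
  rw [Finset.mul_sum]
  refine Finset.sum_congr rfl fun b' _ => ?_
  simp only [Pi.smul_apply, smul_eq_mul]
  ring

/-- The ferromagnetic weight `w_J` is continuous in the angle field. -/
theorem ent_continuous_wJ [NeZero L] (J : ℝ) : Continuous (wJ (L := L) J) := by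
  unfold wJ; fun_prop

/-- The perturbation `W_K` is continuous in the angle field. -/
theorem ent_continuous_Wk [NeZero L] (K : Bond L → Bond L → ℂ) : Continuous (Wk K) := by
  unfold Wk cur; fun_prop

/-- Uniform bound on the weight: `‖w_J(θ)‖ ≤ exp(|J| · #bonds)`. -/
theorem ent_norm_wJ_le [NeZero L] (J : ℝ) (θ : TorusSite 3 L → ℝ) :
    ‖wJ J θ‖ ≤ Real.exp (|J| * ∑ _b : Bond L, (1 : ℝ)) := by
  unfold wJ
  rw [Complex.norm_real, Real.norm_eq_abs, Real.abs_exp]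
  refine Real.exp_le_exp.2 ?_
  calc J * ∑ b : Bond L, Real.cos (θ (b.1 + Pi.single b.2 1) - θ b.1)
      ≤ |J * ∑ b : Bond L, Real.cos (θ (b.1 + Pi.single b.2 1) - θ b.1)| := le_abs_self _
    _ = |J| * |∑ b : Bond L, Real.cos (θ (b.1 + Pi.single b.2 1) - θ b.1)| := abs_mul _ _
    _ ≤ |J| * ∑ b : Bond L, |Real.cos (θ (b.1 + Pi.single b.2 1) - θ b.1)| :=
        mul_le_mul_of_nonneg_left (Finset.abs_sum_le_sum_abs _ _) (abs_nonneg _)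
    _ ≤ |J| * ∑ _b : Bond L, (1 : ℝ) := by
        gcongr with b _
        exact Real.abs_cos_le_one _

/-- Uniform bound on the perturbation: `‖W_K(θ)‖ ≤ Σ_{b,b'} ‖K(b,b')‖` (currents are sines). -/
theorem ent_norm_Wk_le [NeZero L] (K : Bond L → Bond L → ℂ) (θ : TorusSite 3 L → ℝ) :
    ‖Wk K θ‖ ≤ ∑ b : Bond L, ∑ b' : Bond L, ‖K b b'‖ := by
  unfold Wk
  refine (norm_sum_le _ _).trans (Finset.sum_le_sum fun b _ => ?_)
  refine (norm_sum_le _ _).trans (Finset.sum_le_sum fun b' _ => ?_)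
  have h1 : ‖(cur b θ : ℂ)‖ ≤ 1 := by
    rw [Complex.norm_real, Real.norm_eq_abs]; exact Real.abs_sin_le_one _
  have h2 : ‖(cur b' θ : ℂ)‖ ≤ 1 := by
    rw [Complex.norm_real, Real.norm_eq_abs]; exact Real.abs_sin_le_one _
  calc ‖K b b' * (cur b θ : ℂ) * (cur b' θ : ℂ)‖ = ‖K b b'‖ * ‖(cur b θ : ℂ)‖ * ‖(cur b' θ : ℂ)‖ := by
        rw [norm_mul, norm_mul]
    _ ≤ ‖K b b'‖ * 1 * 1 := by gcongr
    _ = ‖K b b'‖ := by ring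

/-- **Analyticity in the coupling.** For fixed `J, L, K` the maps `t ↦ Z(tK)` and `t ↦ num(tK)` are complex
differentiable on `ℂ`: integrals over the compact cube of `w_J(θ) exp(t W_K(θ))` (resp. times `cos(θ_x − θ_y)`), whose
`t`-derivative `W_K w_J e^{tW_K}` is bounded on compacts (`hasDerivAt_integral_of_dominated_loc_of_deriv_le`). [folklore] -/
theorem stub_entire :
    ∀ (J : ℝ) (L : ℕ) [NeZero L] (K : Bond L → Bond L → ℂ),
      Differentiable ℂ (fun t : ℂ => Zk J (t • K)) ∧ Differentiable ℂ (fun t : ℂ => num J (t • K)) := by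
  intro J L _ K
  haveI := ent_isFiniteMeasure_restrict_cube (L := L)
  have hwJ : AEStronglyMeasurable (wJ (L := L) J) (volume.restrict (cube L)) :=
    (ent_continuous_wJ J).aestronglyMeasurable
  have hWk : AEStronglyMeasurable (Wk K) (volume.restrict (cube L)) :=
    (ent_continuous_Wk K).aestronglyMeasurable
  constructor
  · have h : (fun t : ℂ => Zk J (t • K)) =
        fun t => ∫ θ, wJ J θ * Complex.exp (t * Wk K θ) ∂(volume.restrict (cube L)) := by
      funext t; unfold Zk; simp_rw [ent_Wk_smul]
    rw [h]
    exact ent_differentiable_integral_mul_cexp hwJ hWk (ent_norm_wJ_le J) (ent_norm_Wk_le K)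
  · have h : (fun t : ℂ => num J (t • K)) = fun t => ∑ x : TorusSite 3 L, ∑ y : TorusSite 3 L,
        ∫ θ, ((Real.cos (θ x - θ y) : ℂ) * wJ J θ) * Complex.exp (t * Wk K θ) ∂(volume.restrict (cube L)) := by
      funext t; unfold num; simp_rw [ent_Wk_smul, mul_assoc]
    rw [h]
    refine Differentiable.fun_sum fun x _ => Differentiable.fun_sum fun y _ => ?_
    have hcos : Continuous fun θ : TorusSite 3 L → ℝ => ((Real.cos (θ x - θ y) : ℝ) : ℂ) := by fun_prop
    refine ent_differentiable_integral_mul_cexp (hcos.aestronglyMeasurable.mul hwJ) hWk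
      (G := 1 * Real.exp (|J| * ∑ _b : Bond L, (1 : ℝ))) (fun θ => ?_) (ent_norm_Wk_le K)
    rw [norm_mul]
    refine mul_le_mul ?_ (ent_norm_wJ_le J θ) (norm_nonneg _) zero_le_one
    rw [Complex.norm_real, Real.norm_eq_abs]; exact Real.abs_cos_le_one _

end Summit.HubbardSuperconductivity.HubbardSuperconductivity.Theorems.PerturbedXYOrder

end
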